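import Mathlib

/-!
# The ε-deformed cone system: calculus of the thin-cone corner (K28)

Solo seat `solo-NavierStokesRegularity-informed`, session 13; companion of
`paper/axisymmetric-rigidity.md` §5e. Near the axis corner `z₁ → 0` the swirling-cone system (S) is rescaled by
`ε := z₁²`, `t := φ/z₁`, `ṽ := v/z₁`; with `z = √ε` the trigonometric inputs become
`S_ε(t) = sin(z t)/z`, `C_ε(t) = cos(z t)`, `K_ε(t) = z cos(z t)/sin(z t)`, which are regular at `ε = 0`
(the thin-cone limit). This file certifies the dictionary (Lemma 8.19) and the calculus facts that make the polar
trapping Lemma 8.12′ hold verbatim for the deformed system, uniformly in `ε ∈ [0, 1]`: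

* `thinCone_hasDerivAt_S`, `thinCone_hasDerivAt_C`, `thinCone_pythag`, `thinCone_riccati`:
  `S' = C`, `C' = -ε S`, `C² + ε S² = 1`, `K' = -ε - K²`;
* `thinCone_chain`, `thinCone_chain_div` (chain rule for `t = φ/z`) and `thinCone_rescale_R/D/A/P`,
  `thinCone_rescale_flux` (the four equations and the flux `v sin φ = z² ṽ S_ε` transform as stated);
* `thinCone_flux_eq`, `thinCone_swirl_eq`, `thinCone_pressure_eq`: the equations for `Ṽ = ṽ S_ε`, `S̃ = s S_ε` used in the
  proof of Lemma 8.12′ (`Ṽ_t = -3u S_ε`, the `K`-terms cancelling because `K S = C`);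
* `thinCone_S_upper`, `thinCone_S_lower`, `thinCone_hasDerivAt_invSsq`: `0.95 t ≤ S_ε(t) ≤ t` on `[0, 1/2]` for
  `0 < z ≤ 1`, and `d/dt(-1/S²) = 2C/S³`;
* `thinCone_exp_log_bound`: `|log(a/b)| ≤ L ⇒ a ≤ e^L b` — the step by which Lemma 8.12′ replaces hypothesis (C0) of
  Lemma 8.12 with the definition `S̄ := e^L |S*|`.
No new definitions; axioms: standard.
-/

namespace Summit.NavierStokesRegularity.NavierStokesRegularity.Theorems

/-- The linear substitution `t ↦ z t` has derivative `z`. -/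
theorem thinCone_lin (z t : ℝ) : HasDerivAt (fun t => z * t) z t := by
  simpa using (hasDerivAt_id t).const_mul z

/-- `S_ε' = C_ε`: with `z ≠ 0`, `d/dt [sin(z t)/z] = cos(z t)`. -/
theorem thinCone_hasDerivAt_S {z : ℝ} (hz : z ≠ 0) (t : ℝ) :
    HasDerivAt (fun t => Real.sin (z * t) / z) (Real.cos (z * t)) t := by
  have h : HasDerivAt (fun t => Real.sin (z * t) / z) (Real.cos (z * t) * z / z) t :=
    ((Real.hasDerivAt_sin (z * t)).comp t (thinCone_lin z t)).div_const z
  refine h.congr_deriv ?_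
  field_simp

/-- `C_ε' = -ε S_ε` (`ε = z²`). -/
theorem thinCone_hasDerivAt_C {z : ℝ} (hz : z ≠ 0) (t : ℝ) :
    HasDerivAt (fun t => Real.cos (z * t)) (-(z ^ 2) * (Real.sin (z * t) / z)) t := by
  have h : HasDerivAt (fun t => Real.cos (z * t)) (-Real.sin (z * t) * z) t :=
    (Real.hasDerivAt_cos (z * t)).comp t (thinCone_lin z t)
  refine h.congr_deriv ?_
  field_simp

/-- `C_ε² + ε S_ε² = 1`. -/
theorem thinCone_pythag {z : ℝ} (hz : z ≠ 0) (t : ℝ) :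
    Real.cos (z * t) ^ 2 + z ^ 2 * (Real.sin (z * t) / z) ^ 2 = 1 := by
  have h : z ^ 2 * (Real.sin (z * t) / z) ^ 2 = Real.sin (z * t) ^ 2 := by
    field_simp
  rw [h]
  exact Real.cos_sq_add_sin_sq _

/-- The Riccati equation `K_ε' = -ε - K_ε²` for `K_ε(t) = z cos(z t)/sin(z t)` (away from the zeros of `sin(z t)`). -/
theorem thinCone_riccati {z t : ℝ} (hs : Real.sin (z * t) ≠ 0) :
    HasDerivAt (fun t => z * Real.cos (z * t) / Real.sin (z * t))
      (-(z ^ 2) - (z * Real.cos (z * t) / Real.sin (z * t)) ^ 2) t := by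
  have hc := ((Real.hasDerivAt_cos (z * t)).comp t (thinCone_lin z t)).const_mul z
  have hsn := (Real.hasDerivAt_sin (z * t)).comp t (thinCone_lin z t)
  have h : HasDerivAt (fun t => z * Real.cos (z * t) / Real.sin (z * t))
      ((z * (-Real.sin (z * t) * z) * Real.sin (z * t) - z * Real.cos (z * t) * (Real.cos (z * t) * z))
        / Real.sin (z * t) ^ 2) t := hc.div hsn hs
  refine h.congr_deriv ?_
  rw [div_pow, div_eq_iff (pow_ne_zero 2 hs)]
  field_simp

/-- Chain rule for the rescaling `t = φ/z`: `d/dt u(z t) = z u'(z t)`. -/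
theorem thinCone_chain {u : ℝ → ℝ} {du z t : ℝ} (hu : HasDerivAt u du (z * t)) :
    HasDerivAt (fun t => u (z * t)) (z * du) t := by
  have h : HasDerivAt (fun t => u (z * t)) (du * z) t := hu.comp t (thinCone_lin z t)
  refine h.congr_deriv ?_
  ring

/-- Chain rule for the rescaled meridional velocity `ṽ(t) = v(z t)/z`: `ṽ'(t) = v'(z t)`. -/
theorem thinCone_chain_div {v : ℝ → ℝ} {dv z t : ℝ} (hz : z ≠ 0) (hv : HasDerivAt v dv (z * t)) :
    HasDerivAt (fun t => v (z * t) / z) dv t := by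
  have h : HasDerivAt (fun t => v (z * t) / z) (dv * z / z) t := (hv.comp t (thinCone_lin z t)).div_const z
  refine h.congr_deriv ?_
  field_simp

/-- Lemma 8.19, radial equation: `v u_φ = v² + s² - 2p - u - u²` becomes `ṽ u_t = ε ṽ² + s² - 2p - u - u²`
(`ṽ = v/z`, `u_t = z u_φ`, `ε = z²`). -/
theorem thinCone_rescale_R {z v du s p u : ℝ} (hz : z ≠ 0)
    (h : v * du = v ^ 2 + s ^ 2 - 2 * p - u - u ^ 2) :
    (v / z) * (z * du) = z ^ 2 * (v / z) ^ 2 + s ^ 2 - 2 * p - u - u ^ 2 := by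
  have h1 : (v / z) * (z * du) = v * du := by field_simp
  have h2 : z ^ 2 * (v / z) ^ 2 = v ^ 2 := by field_simp
  rw [h1, h2, h]

/-- Lemma 8.19, divergence equation: `v_φ = -3u - v cot φ` becomes `ṽ_t = -3u - ṽ K_ε` with `K_ε = z cot(z t)`. -/
theorem thinCone_rescale_D {z v dv u co si : ℝ} (hz : z ≠ 0)
    (h : dv = -3 * u - v * (co / si)) :
    dv = -3 * u - (v / z) * (z * co / si) := by
  rw [h]
  field_simp

/-- Lemma 8.19, swirl equation: `v s_φ = -s(1 + 2u + v cot φ)` becomes `ṽ s_t = -s(1 + 2u + ṽ K_ε)`. -/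
theorem thinCone_rescale_A {z v ds s u co si : ℝ} (hz : z ≠ 0)
    (h : v * ds = -s * (1 + 2 * u + v * (co / si))) :
    (v / z) * (z * ds) = -s * (1 + 2 * u + (v / z) * (z * co / si)) := by
  have h1 : (v / z) * (z * ds) = v * ds := by field_simp
  have h2 : (v / z) * (z * co / si) = v * (co / si) := by
    rw [mul_div_assoc]
    field_simp
  rw [h1, h2, h]

/-- Lemma 8.19, polar (pressure) equation: `p_φ = (u - 1)v + (v² + s²) cot φ` becomes
`p_t = ε(u - 1)ṽ + (ε ṽ² + s²)K_ε` (`p_t = z p_φ`). -/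
theorem thinCone_rescale_P {z v dp s u co si : ℝ} (hz : z ≠ 0)
    (h : dp = (u - 1) * v + (v ^ 2 + s ^ 2) * (co / si)) :
    z * dp = z ^ 2 * (u - 1) * (v / z) + (z ^ 2 * (v / z) ^ 2 + s ^ 2) * (z * co / si) := by
  have h2 : z ^ 2 * (v / z) ^ 2 = v ^ 2 := by field_simp
  have h3 : z ^ 2 * (u - 1) * (v / z) = z * ((u - 1) * v) := by
    field_simp
  rw [h2, h3, h, mul_div_assoc]
  ring

/-- Lemma 8.19, the flux: `V = v sin φ = z² · ṽ · S_ε(t)`, whence `M₀ = z₁² m` exactly. -/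
theorem thinCone_rescale_flux {z : ℝ} (hz : z ≠ 0) (v t : ℝ) :
    v * Real.sin (z * t) = z ^ 2 * (v / z) * (Real.sin (z * t) / z) := by
  field_simp

/-- `Ṽ_t = -3u S_ε`: with `Ṽ = ṽ S`, `ṽ_t = -3u - ṽK`, `S' = C` and `K S = C` the `K`-terms cancel. -/
theorem thinCone_flux_eq {u vt K S C : ℝ} (hK : K * S = C) :
    (-3 * u - vt * K) * S + vt * C = -3 * u * S := by
  linear_combination (-vt) * hK

/-- `S̃_t = -(1 + 2u) S̃ S_ε / Ṽ`: with `S̃ = s S`, `Ṽ = ṽ S`, `ṽ s_t = -s(1 + 2u + ṽK)`, `S' = C`, `K S = C`. -/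
theorem thinCone_swirl_eq {u vt s K S C : ℝ} (hK : K * S = C) (hv : vt ≠ 0) (hS : S ≠ 0) :
    (-s * (1 + 2 * u + vt * K) / vt) * S + s * C = -(1 + 2 * u) * (s * S) * S / (vt * S) := by
  have hC : C = K * S := hK.symm
  subst hC
  field_simp
  ring

/-- The pressure equation in the flux variables: with `ṽ = Ṽ/S`, `s = S̃/S`, `K = C/S`,
`ε(u - 1)ṽ + (ε ṽ² + s²)K = -ε(1 - u)Ṽ/S + (ε Ṽ² + S̃²) C/S³`. -/
theorem thinCone_pressure_eq {e u V St S C : ℝ} (hS : S ≠ 0) :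
    e * (u - 1) * (V / S) + (e * (V / S) ^ 2 + (St / S) ^ 2) * (C / S)
      = -e * (1 - u) * V / S + (e * V ^ 2 + St ^ 2) * C / S ^ 3 := by
  field_simp
  ring

/-- `S_ε(t) ≤ t` for `z > 0`, `t ≥ 0` (`sin x ≤ x`). -/
theorem thinCone_S_upper {z t : ℝ} (hz : 0 < z) (ht : 0 ≤ t) : Real.sin (z * t) / z ≤ t := by
  rw [div_le_iff₀ hz]
  have := Real.sin_le (mul_nonneg hz.le ht)
  linarith [mul_comm z t]

/-- `S_ε(t) ≥ 0.95 t` for `0 < z ≤ 1`, `0 ≤ t ≤ 1/2` (the constant `1/0.95 = 1.053` of Lemma 8.12, uniformly in `ε ≤ 1`). -/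
theorem thinCone_S_lower {z t : ℝ} (hz : 0 < z) (hz1 : z ≤ 1) (ht0 : 0 ≤ t) (ht : t ≤ 1 / 2) :
    0.95 * t ≤ Real.sin (z * t) / z := by
  rw [le_div_iff₀ hz]
  have hx0 : 0 ≤ z * t := mul_nonneg hz.le ht0
  have hx1 : z * t ≤ 1 / 2 := by nlinarith
  have hb := Real.sin_bound (show |z * t| ≤ 1 by rw [abs_of_nonneg hx0]; linarith)
  rw [abs_of_nonneg hx0] at hb
  have h2 := (abs_le.mp hb).1
  have hx4 : (z * t) ^ 4 ≤ (z * t) * (1 / 8) := by nlinarith [pow_le_pow_left₀ hx0 hx1 3]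
  have hx3 : (z * t) ^ 3 ≤ (z * t) * (1 / 4) := by nlinarith [pow_le_pow_left₀ hx0 hx1 2]
  nlinarith

/-- `d/dt(-1/S_ε²) = 2 C_ε/S_ε³` (the weight identity of the trapping bootstrap, for the deformed system). -/
theorem thinCone_hasDerivAt_invSsq {z t : ℝ} (hz : z ≠ 0) (hs : Real.sin (z * t) ≠ 0) :
    HasDerivAt (fun t => -1 / (Real.sin (z * t) / z) ^ 2)
      (2 * Real.cos (z * t) / (Real.sin (z * t) / z) ^ 3) t := by
  have hS := thinCone_hasDerivAt_S hz t
  have hne : Real.sin (z * t) / z ≠ 0 := div_ne_zero hs hz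
  have hg : HasDerivAt (fun t => (Real.sin (z * t) / z) ^ 2)
      (Real.cos (z * t) * (Real.sin (z * t) / z) + (Real.sin (z * t) / z) * Real.cos (z * t)) t := by
    have := hS.mul hS
    refine (this.congr_deriv rfl).congr_of_eventuallyEq ?_
    exact Filter.Eventually.of_forall fun x => by simp [pow_two]
  have h : HasDerivAt (fun t => -1 / (Real.sin (z * t) / z) ^ 2)
      ((0 * (Real.sin (z * t) / z) ^ 2 - (-1) * (Real.cos (z * t) * (Real.sin (z * t) / z)
        + (Real.sin (z * t) / z) * Real.cos (z * t))) / ((Real.sin (z * t) / z) ^ 2) ^ 2) t :=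
    (hasDerivAt_const t (-1 : ℝ)).div hg (pow_ne_zero 2 hne)
  refine h.congr_deriv ?_
  field_simp
  ring

/-- Lemma 8.12′: `|log(a/b)| ≤ L` with `a, b > 0` gives `a ≤ e^L · b` — so the swirl bound `S̄ := e^L |S*|` may be
defined from `L` instead of being fixed in advance (this removes hypothesis (C0) of Lemma 8.12). -/
theorem thinCone_exp_log_bound {a b L : ℝ} (ha : 0 < a) (hb : 0 < b) (h : |Real.log (a / b)| ≤ L) :
    a ≤ Real.exp L * b := by
  have h1 : Real.log (a / b) ≤ L := (abs_le.mp h).2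
  have h2 : a / b ≤ Real.exp L := by
    calc a / b = Real.exp (Real.log (a / b)) := (Real.exp_log (div_pos ha hb)).symm
      _ ≤ Real.exp L := Real.exp_le_exp.mpr h1
  rwa [div_le_iff₀ hb] at h2

end Summit.NavierStokesRegularity.NavierStokesRegularity.Theorems
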